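import Summits.QuantumFields.YangMills.Theorems.BalabanUVNodesK0RecordFormatNamesL

/-!
# K0⁷ record FORMAT⁺ names — lemma file 9: faces of EDITION 14 (the (21)-Landau re-gauged response, Q-12 repair (ρ1) variant (L))

Companion of `…K0RecordFormatNamesL`.  Kernel-checked bookkeeping over the tree's Landau normalisation (`B6SectAWholeTorusBridge.existsUnique_landauGauge`,
[B6] (2.12)); nothing of Bałaban's asserted.  DEFINER seat `ym-nodeO-def-1` (gen 34); `--kind proof --supports stmt-QuantumFields-20541 --as helper`; count-neutral.

* §1 `landauPot`: its SPEC on the standing range (vanishing iterated block averages; `x − grad n ∈ lan`), UNIQUENESS (any `n` with the spec IS it — selection-free),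
  ℝ-LINEARITY (`add`∕`smul`, from uniqueness), and the decomposition `x = landauRep x + grad (landauPot x)` with `landauRep x ∈ lan`.
* §2 entrywise: `recordD = recordHr + d(landauPotC ∘ recordD)` bond by bond (TokP9L's `D = Hr + dφ` with the NAMED `φ`; sign: `grad n b = n b.tgt − n b.src`),
  and the re∕im parts of `recordHr` lie in the Landau subspace.
* §3 `recordGkL`: the `𝐉`-block IS `recordGkJ`'s (`rfl`-grade), the `𝐔`-block reads `recordHr`.

HONEST FRAMING.  Bookkeeping; 27931 ⁷‴ not yet cut; nothing of Bałaban asserted, ported or discharged; K0⁷ NOT closed; NODE O 0∕1; COUNT 8∕28 · K 1∕4 UNMOVED; finite 𝕋⁴ at fixed ε —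
not continuum ∕ OS ∕ Clay; the Yang–Mills mass gap is NOT proved by any of this.
-/

noncomputable section

open scoped BigOperators Matrix.Norms.L2Operator

namespace Summit.QuantumFields.YangMills.Theorems.K0RecordFormatNames

open Literature.MathematicalPhysics.QuantumFieldTheory.Balaban1983to89
open Literature.MathematicalPhysics.QuantumFieldTheory.Balaban1983to89.Node00
open Literature.MathematicalPhysics.QuantumFieldTheory.Balaban1983to89.T4Continuum (T4Family)
open Literature.MathematicalPhysics.QuantumFieldTheory.BalabanImbrieJaffe1984to88.BIJ85AxialPropagator411 (BondSpace)
open Literature.MathematicalPhysics.QuantumFieldTheory.Balaban1983to89.B6SectAOperatorsV1 (ScalarSpace)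
open Literature.MathematicalPhysics.QuantumFieldTheory.BalabanImbrieJaffe1984to88.BIJ85LandauMinimizer442V1 (gradV1 gradV1_apply)
open Literature.MathematicalPhysics.QuantumFieldTheory.BalabanImbrieJaffe1984to88.BIJ85GaugeFunction5113 (grad_add grad_smul siteAvgIter_add siteAvgIter_smul)
open Literature.MathematicalPhysics.QuantumFieldTheory.Balaban1983to89.B5Eq164LandauV1 (lan)
open Literature.MathematicalPhysics.QuantumFieldTheory.Balaban1983to89.LatticeFieldCalculus (siteAvgIter grad)

variable (F : T4Family)

/-! ## §1  `landauPot`: spec, uniqueness, linearity; `landauRep ∈ lan` and the decomposition -/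

/-- **THE SPEC of the Landau potential on the standing range**: vanishing iterated block averages and `x − grad n` in the Landau subspace ([B6] (2.12) existence half).
[cite: Balaban1984PropagatorsII, (2.10)–(2.12) p.225] -/
theorem landauPot_spec {k K : ℕ} (h : k + 1 ≤ (F.P K).m + (F.P K).K) (x : BondSpace (F.P K)) :
    siteAvgIter (k + 1) (WithLp.ofLp (landauPot F k K x)) = 0 ∧ x - gradV1 (F.P K) 1 (landauPot F k K x) ∈ lan (F.P K) (k + 1) 1 1 := by
  unfold landauPot
  rw [dif_pos h]
  exact (B6SectAWholeTorusBridge.existsUnique_landauGauge (P := F.P K) (k := k + 1) h (c := (1 : ℝ)) (s := (1 : ℝ))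
    one_ne_zero one_ne_zero x).exists.choose_spec

/-- **UNIQUENESS (selection-freeness)**: ANY potential with the spec IS `landauPot` ([B6] (2.12) «exactly one»). [cite: Balaban1984PropagatorsII, (2.12) p.225] -/
theorem landauPot_eq_of_spec {k K : ℕ} (h : k + 1 ≤ (F.P K).m + (F.P K).K) (x : BondSpace (F.P K)) {n : ScalarSpace (F.P K)}
    (hn : siteAvgIter (k + 1) (WithLp.ofLp n) = 0 ∧ x - gradV1 (F.P K) 1 n ∈ lan (F.P K) (k + 1) 1 1) : landauPot F k K x = n :=
  (B6SectAWholeTorusBridge.existsUnique_landauGauge (P := F.P K) (k := k + 1) h (c := (1 : ℝ)) (s := (1 : ℝ)) one_ne_zero one_ne_zero x).unique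
    (landauPot_spec F h x) hn

/-- Off the standing range the potential is the junk `0`. [cite: Balaban1984PropagatorsII, (2.12) p.225 (bookkeeping)] -/
theorem landauPot_of_not_le {k K : ℕ} (h : ¬ k + 1 ≤ (F.P K).m + (F.P K).K) (x : BondSpace (F.P K)) : landauPot F k K x = 0 := by
  unfold landauPot
  rw [dif_neg h]

/-- **ADDITIVITY** of the Landau potential (the spec is linear and the solution unique). [cite: Balaban1984PropagatorsII, (2.12) p.225 (bookkeeping)] -/
theorem landauPot_add (k K : ℕ) (x y : BondSpace (F.P K)) : landauPot F k K (x + y) = landauPot F k K x + landauPot F k K y := by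
  by_cases h : k + 1 ≤ (F.P K).m + (F.P K).K
  · refine landauPot_eq_of_spec F h (x + y) ⟨?_, ?_⟩
    · rw [WithLp.ofLp_add, siteAvgIter_add, (landauPot_spec F h x).1, (landauPot_spec F h y).1, add_zero]
    · have e : x + y - gradV1 (F.P K) 1 (landauPot F k K x + landauPot F k K y) =
          (x - gradV1 (F.P K) 1 (landauPot F k K x)) + (y - gradV1 (F.P K) 1 (landauPot F k K y)) := by
        rw [map_add]; abel
      rw [e]
      exact Submodule.add_mem _ (landauPot_spec F h x).2 (landauPot_spec F h y).2
  · simp only [landauPot_of_not_le F h, add_zero]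

/-- **HOMOGENEITY** of the Landau potential. [cite: Balaban1984PropagatorsII, (2.12) p.225 (bookkeeping)] -/
theorem landauPot_smul (k K : ℕ) (t : ℝ) (x : BondSpace (F.P K)) : landauPot F k K (t • x) = t • landauPot F k K x := by
  by_cases h : k + 1 ≤ (F.P K).m + (F.P K).K
  · refine landauPot_eq_of_spec F h (t • x) ⟨?_, ?_⟩
    · rw [WithLp.ofLp_smul, siteAvgIter_smul, (landauPot_spec F h x).1, smul_zero]
    · have e : t • x - gradV1 (F.P K) 1 (t • landauPot F k K x) = t • (x - gradV1 (F.P K) 1 (landauPot F k K x)) := by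
        rw [map_smul, smul_sub]
      rw [e]
      exact Submodule.smul_mem _ t (landauPot_spec F h x).2
  · simp only [landauPot_of_not_le F h, smul_zero]

/-- The Landau potential of `0` is `0`. [cite: Balaban1984PropagatorsII, (2.12) p.225 (bookkeeping)] -/
theorem landauPot_zero (k K : ℕ) : landauPot F k K 0 = 0 := by
  simpa using landauPot_smul F k K 0 0

/-- **THE DECOMPOSITION**: `x = landauRep x + grad (landauPot x)` — TokP9L's «`D = Hr + dφ`» with the NAMED potential. [cite: Balaban1985Variational, (21) p.281; Balaban1984PropagatorsII, (2.12) p.225] -/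
theorem landauRep_add_grad (k K : ℕ) (x : BondSpace (F.P K)) : landauRep F k K x + gradV1 (F.P K) 1 (landauPot F k K x) = x :=
  sub_add_cancel x _

/-- **The Landau representative lies in the Landau subspace** `{R∂*A = 0}` (on the standing range). [cite: Balaban1984PropagatorsI, (1.47) p.26; Balaban1985Variational, (21) p.281] -/
theorem landauRep_mem_lan {k K : ℕ} (h : k + 1 ≤ (F.P K).m + (F.P K).K) (x : BondSpace (F.P K)) : landauRep F k K x ∈ lan (F.P K) (k + 1) 1 1 :=
  (landauPot_spec F h x).2

/-- The Landau representative is additive. [cite: Balaban1984PropagatorsII, (2.12) p.225 (bookkeeping)] -/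
theorem landauRep_add (k K : ℕ) (x y : BondSpace (F.P K)) : landauRep F k K (x + y) = landauRep F k K x + landauRep F k K y := by
  simp only [landauRep, landauPot_add, map_add]; abel

/-- The Landau representative is homogeneous. [cite: Balaban1984PropagatorsII, (2.12) p.225 (bookkeeping)] -/
theorem landauRep_smul (k K : ℕ) (t : ℝ) (x : BondSpace (F.P K)) : landauRep F k K (t • x) = t • landauRep F k K x := by
  simp only [landauRep, landauPot_smul, map_smul, smul_sub]

/-- Bondwise form of the decomposition: `x b = landauRep x b + (n b.tgt − n b.src)`, `n = landauPot x` (the tree's `grad 1 n b = 1 • (n b.tgt − n b.src)`).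
[cite: Balaban1984PropagatorsI, (1.20) p.20; Balaban1985Variational, (21) p.281] -/
theorem landauRep_apply_add (k K : ℕ) (x : BondSpace (F.P K)) (b : PBond (F.P K) 0) :
    WithLp.ofLp (landauRep F k K x) b +
        (WithLp.ofLp (landauPot F k K x) b.tgt - WithLp.ofLp (landauPot F k K x) b.src) = WithLp.ofLp x b := by
  simp only [landauRep, WithLp.ofLp_sub, Pi.sub_apply, gradV1_apply, grad, one_smul]
  ring

/-! ## §2  Entrywise: `recordD = recordHr + d(landauPotC ∘ recordD)`; re∕im of `recordHr` in the Landau subspace -/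

/-- The complex re-gauging, bondwise: `x b = landauRepC x b + (landauPotC x b.tgt − landauPotC x b.src)`. [cite: Balaban1985Variational, (21) p.281 (bookkeeping)] -/
theorem landauRepC_add_grad (k K : ℕ) (x : PBond (F.P K) 0 → ℂ) (b : PBond (F.P K) 0) :
    landauRepC F k K x b + (landauPotC F k K x b.tgt - landauPotC F k K x b.src) = x b := by
  have hre := landauRep_apply_add F k K (reBond F K x) b
  have him := landauRep_apply_add F k K (imBond F K x) b
  have hre' : WithLp.ofLp (reBond F K x) b = (x b).re := rfl
  have him' : WithLp.ofLp (imBond F K x) b = (x b).im := rfl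
  rw [hre'] at hre
  rw [him'] at him
  apply Complex.ext
  · simp [landauRepC, landauPotC]
    linarith
  · simp [landauRepC, landauPotC]
    linarith

section Landau

variable (θ : Stage13Params F 2)

/-- ★ **`D = Hr + dφ` AT THE NAMES**, entry by entry and bond by bond, with `φ := landauPotC ∘ D`: the TokP9L decomposition is an IDENTITY for the ed.14 objects.
[cite: Balaban1985Variational, Prop. 9 p.309, (190) p.308, (21) p.281] -/
theorem recordD_eq_recordHr_add (k K : ℕ) (a : θ.ιβ) (l : RespLabel F k K) (b : PBond (F.P K) 0) (i i' : Fin 2) :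
    recordD F θ k K a l b i i' = recordHr F θ k K a l b i i' +
      (landauPotC F k K (fun b' => recordD F θ k K a l b' i i') b.tgt - landauPotC F k K (fun b' => recordD F θ k K a l b' i i') b.src) :=
  (landauRepC_add_grad F k K (fun b' => recordD F θ k K a l b' i i') b).symm

/-- The REAL part of every matrix entry of `Hr` is a Landau-subspace bond field (on the standing range). [cite: Balaban1985Variational, (21) p.281; Balaban1984PropagatorsI, (1.47) p.26] -/
theorem reBond_recordHr_mem_lan {k K : ℕ} (h : k + 1 ≤ (F.P K).m + (F.P K).K) (a : θ.ιβ) (l : RespLabel F k K) (i i' : Fin 2) :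
    reBond F K (fun b => recordHr F θ k K a l b i i') ∈ lan (F.P K) (k + 1) 1 1 := by
  have hm := landauRep_mem_lan F h (reBond F K fun b' => recordD F θ k K a l b' i i')
  have e : reBond F K (fun b => recordHr F θ k K a l b i i') = landauRep F k K (reBond F K fun b' => recordD F θ k K a l b' i i') := by
    apply WithLp.ofLp_injective 2
    funext b
    simp [reBond, recordHr, landauRepC]
  rw [e]; exact hm

/-- The IMAGINARY part of every matrix entry of `Hr` is a Landau-subspace bond field (on the standing range). [cite: Balaban1985Variational, (21) p.281; Balaban1984PropagatorsI, (1.47) p.26] -/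
theorem imBond_recordHr_mem_lan {k K : ℕ} (h : k + 1 ≤ (F.P K).m + (F.P K).K) (a : θ.ιβ) (l : RespLabel F k K) (i i' : Fin 2) :
    imBond F K (fun b => recordHr F θ k K a l b i i') ∈ lan (F.P K) (k + 1) 1 1 := by
  have hm := landauRep_mem_lan F h (imBond F K fun b' => recordD F θ k K a l b' i i')
  have e : imBond F K (fun b => recordHr F θ k K a l b i i') = landauRep F k K (imBond F K fun b' => recordD F θ k K a l b' i i') := by
    apply WithLp.ofLp_injective 2
    funext b
    simp [imBond, recordHr, landauRepC]
  rw [e]; exact hm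

/-! ## §3  `recordGkL`: blocks -/

/-- The `𝐉`-block of the re-gauged response IS the `𝐉`-block of `recordGkJ` (unchanged by construction). [cite: Balaban1987RG1, (1.8)–(1.9) p.261 (bookkeeping)] -/
theorem recordGkL_inr (k K : ℕ) (a : θ.ιβ) (l : RespLabel F k K) (b : PBond (F.P K) 0) (c : Fin 3) :
    recordGkL F θ k K a l (chartEquivJ F K (b, Sum.inr c)) = recordGkJ F θ k K a l (chartEquivJ F K (b, Sum.inr c)) := by
  simp [recordGkL]

/-- The `𝐔`-block of the re-gauged response reads `Hr`. [cite: Balaban1987RG1, (4.35) p.290; Balaban1985Variational, (21) p.281 (bookkeeping)] -/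
theorem recordGkL_inl (k K : ℕ) (a : θ.ιβ) (l : RespLabel F k K) (b : PBond (F.P K) 0) (c : Fin 3) :
    recordGkL F θ k K a l (chartEquivJ F K (b, Sum.inl c)) = sl2Coord (Matrix.of fun i₁ i₂ => recordHr F θ k K a l b i₁ i₂) c := by
  simp [recordGkL]

/-- The L-layer response data's `Gk` field (`rfl`). [cite: Balaban1985Variational, Prop. 9 p.309 (bookkeeping)] -/
theorem recordResponse9DataFromL_Gk (a : θ.ιβ) (Mc k K₀ n : ℕ) :
    (recordResponse9DataFromL F θ a Mc k K₀).Gk n = recordGkL F θ k (K₀ + n) a := rfl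

/-- Every geometric field of the L-layer data is the `…J` data's (`rfl` ×5). [cite: Balaban1987RG1, (1.21) p.264 (bookkeeping)] -/
theorem recordResponse9DataFromL_geom (a : θ.ιβ) (Mc k K₀ : ℕ) :
    (recordResponse9DataFromL F θ a Mc k K₀).cX = (recordResponse9DataFromJ F θ a Mc k K₀).cX ∧
      (recordResponse9DataFromL F θ a Mc k K₀).wrap = (recordResponse9DataFromJ F θ a Mc k K₀).wrap ∧
      (recordResponse9DataFromL F θ a Mc k K₀).emb = (recordResponse9DataFromJ F θ a Mc k K₀).emb ∧
      (recordResponse9DataFromL F θ a Mc k K₀).e = (recordResponse9DataFromJ F θ a Mc k K₀).e ∧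
      (recordResponse9DataFromL F θ a Mc k K₀).ρ = (recordResponse9DataFromJ F θ a Mc k K₀).ρ :=
  ⟨rfl, rfl, rfl, rfl, rfl⟩

end Landau

/-! ## §4  (v2 APPEND, porter PT-B-1's (F1)) `landauRepC` is ℝ-LINEAR in the bond function and kills `0`; hence `Hr` inherits every ENTRYWISE-LINEAR identity of `D`
(tracelessness: `tr D(b) = 0 ⇒ tr Hr(b) = 0`) -/

/-- **(F1a) `landauRepC` is ADDITIVE in the bond function.** [cite: Balaban1984PropagatorsII, (2.12) p.225 (bookkeeping)] -/
theorem landauRepC_add (k K : ℕ) (x y : PBond (F.P K) 0 → ℂ) (b : PBond (F.P K) 0) :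
    landauRepC F k K (fun b' => x b' + y b') b = landauRepC F k K x b + landauRepC F k K y b := by
  have hre : reBond F K (fun b' => x b' + y b') = reBond F K x + reBond F K y := by
    apply WithLp.ofLp_injective 2; funext b'; simp [reBond]
  have him : imBond F K (fun b' => x b' + y b') = imBond F K x + imBond F K y := by
    apply WithLp.ofLp_injective 2; funext b'; simp [imBond]
  simp only [landauRepC, hre, him, landauRep_add, WithLp.ofLp_add, Pi.add_apply]
  push_cast
  ring

/-- **(F1b) `landauRepC` is ℝ-HOMOGENEOUS in the bond function.** [cite: Balaban1984PropagatorsII, (2.12) p.225 (bookkeeping)] -/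
theorem landauRepC_smul (k K : ℕ) (t : ℝ) (x : PBond (F.P K) 0 → ℂ) (b : PBond (F.P K) 0) :
    landauRepC F k K (fun b' => (t : ℂ) * x b') b = (t : ℂ) * landauRepC F k K x b := by
  have hre : reBond F K (fun b' => (t : ℂ) * x b') = t • reBond F K x := by
    apply WithLp.ofLp_injective 2; funext b'; simp [reBond]
  have him : imBond F K (fun b' => (t : ℂ) * x b') = t • imBond F K x := by
    apply WithLp.ofLp_injective 2; funext b'; simp [imBond]
  simp only [landauRepC, hre, him, landauRep_smul, WithLp.ofLp_smul, Pi.smul_apply, smul_eq_mul]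
  push_cast
  ring

/-- **(F1c) `landauRepC` of the ZERO bond function is zero.** [cite: Balaban1984PropagatorsII, (2.12) p.225 (bookkeeping)] -/
theorem landauRepC_zero (k K : ℕ) (b : PBond (F.P K) 0) : landauRepC F k K (fun _ => (0 : ℂ)) b = 0 := by
  have h := landauRepC_smul F k K 0 (fun _ => (0 : ℂ)) b
  simpa using h

/-- `landauRepC` commutes with finite sums in the bond function. [cite: Balaban1984PropagatorsII, (2.12) p.225 (bookkeeping)] -/
theorem landauRepC_sum {ι : Type*} (s : Finset ι) (k K : ℕ) (x : ι → PBond (F.P K) 0 → ℂ) (b : PBond (F.P K) 0) :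
    landauRepC F k K (fun b' => ∑ j ∈ s, x j b') b = ∑ j ∈ s, landauRepC F k K (x j) b := by
  classical
  induction s using Finset.induction_on with
  | empty => simpa using landauRepC_zero F k K b
  | insert j s hj ih =>
    simp only [Finset.sum_insert hj]
    rw [← ih, ← landauRepC_add]

section LandauTrace

variable (θ : Stage13Params F 2)

/-- **(F1) AT THE NAMES — the trace of `Hr(b)` is the Landau representative of the trace of `D`**: `tr (recordHr … b) = landauRepC (fun b' => tr (recordD … b')) b`.
[cite: Balaban1985Variational, (21) p.281 (bookkeeping)] -/
theorem trace_recordHr (k K : ℕ) (a : θ.ιβ) (l : RespLabel F k K) (b : PBond (F.P K) 0) :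
    Matrix.trace (Matrix.of fun i i' => recordHr F θ k K a l b i i') =
      landauRepC F k K (fun b' => Matrix.trace (Matrix.of fun i i' => recordD F θ k K a l b' i i')) b := by
  simp only [Matrix.trace, Matrix.diag, Matrix.of_apply, recordHr]
  rw [landauRepC_sum]

/-- **… hence `Hr(b)` is TRACELESS whenever `D` is** (the rooted field is `SU(2)`-valued, so `tr D(b′) = 0` — porter PT-B-1's `trace_eq_zero_of_hasFDerivAt_su`).
[cite: Balaban1985Variational, (21) p.281; Balaban1987RG1, (4.35) p.290 (bookkeeping)] -/
theorem trace_recordHr_eq_zero (k K : ℕ) (a : θ.ιβ) (l : RespLabel F k K)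
    (hD : ∀ b', Matrix.trace (Matrix.of fun i i' => recordD F θ k K a l b' i i') = 0) (b : PBond (F.P K) 0) :
    Matrix.trace (Matrix.of fun i i' => recordHr F θ k K a l b i i') = 0 := by
  rw [trace_recordHr]
  have e : (fun b' => Matrix.trace (Matrix.of fun i i' => recordD F θ k K a l b' i i')) = fun _ => (0 : ℂ) := funext hD
  rw [e]
  exact landauRepC_zero F k K b

end LandauTrace

end Summit.QuantumFields.YangMills.Theorems.K0RecordFormatNames

end
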